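import Summits.Ventures.Crystal3D.Theorems.StickyWulffConstantPolycrystalWulffBoundAggRows
import Summits.Ventures.Crystal3D.Theorems.StickyWulffConstantPolycrystalWulffBoundWulffOverlapHyps

/-!
# `PolycrystalWulffBound`, line `PolyDensity`: the static rows for ANY number of classes (aggregated step, part 1)

Route `StickyWulffConstant` of the venture `Summits/Ventures/Crystal3D`, crux `PolycrystalWulffBound`
(item `stmt-Ventures-19482`), second prover lane (poly-p2, gen 4).  `threeClass_staticRows` generalised to a
labelling `cls : Fin n → β` into an arbitrary finite type of classes with bodies `KC i` (`|KC i| = 32`, pair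
overlaps `≥ 27.8`, vertex shaving): the class variables `F, Y, Acl, v` with their defining equations and the
GENERIC static rows of the aggregated LP (`def AggCert27_8`, catalogue `poly-p2/AGG-CATALOGUE.md`): floors,
shaved singles and pairs (any `ε ∈ (0,5)`), unshaved singles / pairs / triples (triple constant `23.6` by
inclusion–exclusion), inscribed-ball blocks and isoperimetric rows for ANY set of classes, and the singles-sum row
for any set of classes (the remainder).  The aggregated step instantiates them at the three largest classes and the
remainder and rounds the constants.
WHAT THIS IS NOT: walls / energy / recolouring / deletion rows (`rec_row_of_IH`, `del_row_of_IH`); F-C1 not moved.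
-/

noncomputable section

namespace Summit.Ventures.Crystal3D.Theorems

open MeasureTheory Set Metric
open scoped RealInnerProductSpace ENNReal Pointwise
open Summit.Ventures.Crystal3D.Cruxes.TextureLiminf.TexShadow
open Literature.Analysis.Convexity
open Literature.MathematicalPhysics.StatisticalMechanics (perimeter HasFinitePerimeter)
open Summit.Ventures.Crystal3D.Cruxes.PolycrystalWulffBound.PolyDensity (toReal_volume_inter_inter_ge)

set_option maxHeartbeats 1600000 in  -- one statement, a dozen generic rows
/-- **Static rows for any number of classes.**  See the module docstring. -/
theorem aggStaticRows {n : ℕ} {β : Type} [Fintype β] [DecidableEq β] (G : Fin n → Set E3)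
    (hfin : ∀ f, HasFinitePerimeter (G f) ∧ volume (G f) < ⊤)
    (hPoly : ∀ f, ∃ (k : ℕ) (H : Fin k → Finset (E3 × ℝ)), G f = ⋃ i, polytope (H i))
    (hdisj : ∀ f g, f ≠ g → Disjoint (G f) (G g))
    (cls : Fin n → β) (KC : β → Set E3)
    (hKc : ∀ i, IsCompact (KC i)) (hKv : ∀ i, Convex ℝ (KC i)) (hK0 : ∀ i, (0 : E3) ∈ KC i)
    (hKs : ∀ i, -KC i = KC i) (hK3 : ∀ i, closedBall (0 : E3) (Real.sqrt 3) ⊆ KC i)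
    (hK5 : ∀ i, KC i ⊆ closedBall (0 : E3) (Real.sqrt 5))
    (hvolK : ∀ i, (volume (KC i)).toReal = 32)
    (hpair : ∀ i j, (27.8 : ℝ) ≤ (volume (KC i ∩ KC j)).toReal)
    (hshave : ∀ i (K : Set E3), K ⊆ KC i → ∀ ε : ℝ, 0 < ε → ε ≤ 5 →
      (volume K).toReal - 8 * ε ^ 3 ≤ (volume (K ∩ closedBall (0 : E3) (Real.sqrt (5 - ε)))).toReal) :
    ∃ (F Y : β → ℝ) (Acl : β → β → ℝ) (v : β → ℝ),
      (F = fun i => ∑ f ∈ Finset.univ.filter (fun f => cls f = i), (per (KC (cls f)) (G f) -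
        ∑ g, (if f = g then 0 else (per (KC (cls f)) (G f) + per (KC (cls f)) (G g) - per (KC (cls f)) (G f ∪ G g)) / 2))) ∧
      (Y = fun i => ∑ f ∈ Finset.univ.filter (fun f => cls f = i), (per (closedBall (0 : E3) 1) (G f) -
        ∑ g, (if f = g then 0 else (per (closedBall (0 : E3) 1) (G f) + per (closedBall (0 : E3) 1) (G g) -
          per (closedBall (0 : E3) 1) (G f ∪ G g)) / 2))) ∧
      (Acl = fun i j => ∑ f ∈ Finset.univ.filter (fun f => cls f = i), ∑ g ∈ Finset.univ.filter (fun f => cls f = j),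
        (per (closedBall (0 : E3) 1) (G f) + per (closedBall (0 : E3) 1) (G g) - per (closedBall (0 : E3) 1) (G f ∪ G g)) / 2) ∧
      (v = fun i => (volume (⋃ f ∈ Finset.univ.filter (fun f => cls f = i), G f)).toReal) ∧
      (volume (⋃ f, G f)).toReal = ∑ i, v i ∧
      (∀ P : Finset β, (volume (⋃ f ∈ Finset.univ.filter (fun f => cls f ∈ P), G f)).toReal = ∑ i ∈ P, v i) ∧
      (∀ i, 0 ≤ v i) ∧ (∀ i, 0 ≤ F i) ∧ (∀ i, 0 ≤ Y i) ∧ (∀ i j, i ≠ j → 0 ≤ Acl i j) ∧ (∀ i j, Acl i j = Acl j i) ∧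
      (∀ i, Real.sqrt 3 * Y i ≤ F i) ∧
      (∀ (i : β) (ε ρq Kq : ℝ), 0 < ε → ε < 5 → Real.sqrt (5 - ε) ≤ ρq → Kq + 8 * ε ^ 3 ≤ 32 → 0 ≤ Kq →
        3 * Kq ^ ((1 : ℝ) / 3) * (v i) ^ ((2 : ℝ) / 3) ≤ F i + ρq * ∑ l ∈ Finset.univ \ {i}, Acl i l) ∧
      (∀ (i j : β) (ε ρq Kq : ℝ), 0 < ε → ε < 5 → Real.sqrt (5 - ε) ≤ ρq → Kq + 8 * ε ^ 3 ≤ 27.8 → 0 ≤ Kq →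
        3 * Kq ^ ((1 : ℝ) / 3) * (∑ k ∈ ({i, j} : Finset β), v k) ^ ((2 : ℝ) / 3) ≤
          (∑ k ∈ ({i, j} : Finset β), F k) + ρq * ∑ k ∈ ({i, j} : Finset β), ∑ l ∈ Finset.univ \ {i, j}, Acl k l) ∧
      (∀ (i : β) (ρq : ℝ), Real.sqrt 5 ≤ ρq →
        3 * (32 : ℝ) ^ ((1 : ℝ) / 3) * (v i) ^ ((2 : ℝ) / 3) ≤ F i + ρq * ∑ l ∈ Finset.univ \ {i}, Acl i l) ∧
      (∀ (i j : β) (ρq : ℝ), Real.sqrt 5 ≤ ρq →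
        3 * (27.8 : ℝ) ^ ((1 : ℝ) / 3) * (∑ k ∈ ({i, j} : Finset β), v k) ^ ((2 : ℝ) / 3) ≤
          (∑ k ∈ ({i, j} : Finset β), F k) + ρq * ∑ k ∈ ({i, j} : Finset β), ∑ l ∈ Finset.univ \ {i, j}, Acl k l) ∧
      (∀ (i j k : β) (ρq : ℝ), Real.sqrt 5 ≤ ρq →
        3 * (23.6 : ℝ) ^ ((1 : ℝ) / 3) * (∑ l ∈ ({i, j, k} : Finset β), v l) ^ ((2 : ℝ) / 3) ≤
          (∑ l ∈ ({i, j, k} : Finset β), F l) + ρq * ∑ l ∈ ({i, j, k} : Finset β), ∑ l' ∈ Finset.univ \ {i, j, k}, Acl l l') ∧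
      (∀ (P : Finset β) (ρq Kq : ℝ), Real.sqrt 3 ≤ ρq → 0 ≤ Kq → Kq ≤ 4 * Real.sqrt 3 * Real.pi →
        3 * Kq ^ ((1 : ℝ) / 3) * (∑ i ∈ P, v i) ^ ((2 : ℝ) / 3) ≤ (∑ i ∈ P, F i) + ρq * ∑ i ∈ P, ∑ j ∈ Finset.univ \ P, Acl i j) ∧
      (∀ P : Finset β, 3 * (Real.pi * 4 / 3) ^ ((1 : ℝ) / 3) * (∑ i ∈ P, v i) ^ ((2 : ℝ) / 3) ≤
        (∑ i ∈ P, Y i) + ∑ i ∈ P, ∑ j ∈ Finset.univ \ P, Acl i j) ∧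
      (∀ (P : Finset β) (ε ρq Kq : ℝ), 0 < ε → ε < 5 → Real.sqrt (5 - ε) ≤ ρq → Kq + 8 * ε ^ 3 ≤ 32 → 0 ≤ Kq →
        3 * Kq ^ ((1 : ℝ) / 3) * (∑ i ∈ P, (v i) ^ ((2 : ℝ) / 3)) ≤ (∑ i ∈ P, F i) + ρq * ∑ i ∈ P, ∑ j ∈ Finset.univ \ {i}, Acl i j) ∧
      (∀ (P : Finset β) (ρq : ℝ), Real.sqrt 5 ≤ ρq →
        3 * (32 : ℝ) ^ ((1 : ℝ) / 3) * (∑ i ∈ P, (v i) ^ ((2 : ℝ) / 3)) ≤ (∑ i ∈ P, F i) + ρq * ∑ i ∈ P, ∑ j ∈ Finset.univ \ {i}, Acl i j) := by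
  classical
  have hvol : ∀ f, volume (G f) < ⊤ := fun f => (hfin f).2
  have hKm : ∀ i, MeasurableSet (KC i) := fun i => (hKc i).measurableSet
  set V : ℝ := (volume (⋃ f, G f)).toReal with hVdef
  set wf : Fin n → Fin n → ℝ := fun f g => (per (Metric.closedBall (0 : E3) 1) (G f) +
    per (Metric.closedBall (0 : E3) 1) (G g) - per (Metric.closedBall (0 : E3) 1) (G f ∪ G g)) / 2 with hwf
  set Frf : Fin n → ℝ := fun f => per (KC (cls f)) (G f) - ∑ g, (if f = g then 0 else
    (per (KC (cls f)) (G f) + per (KC (cls f)) (G g) - per (KC (cls f)) (G f ∪ G g)) / 2) with hFrf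
  set Yf : Fin n → ℝ := fun f => per (Metric.closedBall (0 : E3) 1) (G f) -
    ∑ g, (if f = g then 0 else (per (Metric.closedBall (0 : E3) 1) (G f) +
      per (Metric.closedBall (0 : E3) 1) (G g) - per (Metric.closedBall (0 : E3) 1) (G f ∪ G g)) / 2) with hYf
  set C : β → Finset (Fin n) := fun i => Finset.univ.filter (fun f => cls f = i) with hCdef
  set F : β → ℝ := fun i => ∑ f ∈ C i, Frf f with hF
  set Y : β → ℝ := fun i => ∑ f ∈ C i, Yf f with hY
  set Acl : β → β → ℝ := fun i j => ∑ f ∈ C i, ∑ g ∈ C j, wf f g with hAcl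
  set v : β → ℝ := fun i => (volume (⋃ f ∈ C i, G f)).toReal with hv
  -- basic facts
  have hwf_symm : ∀ f g, wf f g = wf g f := by intro f g; simp only [hwf, Set.union_comm]; ring_nf
  have hwf_nn : ∀ f g, f ≠ g → 0 ≤ wf f g := fun f g hfg =>
    div_nonneg (iota_nonneg_of_poly G hPoly hvol hdisj (isCompact_closedBall (0 : E3) 1)
      (convex_closedBall 0 1) (Metric.mem_closedBall_self zero_le_one) hfg) zero_le_two
  have hAcl_symm : ∀ i j, Acl i j = Acl j i := by
    intro i j; simp only [hAcl]; rw [Finset.sum_comm]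
    exact Finset.sum_congr rfl fun g _ => Finset.sum_congr rfl fun f _ => hwf_symm f g
  have hAcl_nn : ∀ i j, i ≠ j → 0 ≤ Acl i j := by
    intro i j hij
    refine Finset.sum_nonneg fun f hf => Finset.sum_nonneg fun g hg => hwf_nn f g ?_
    intro h; subst h
    exact hij ((Finset.mem_filter.1 hf).2.symm.trans (Finset.mem_filter.1 hg).2)
  have hY_nn : ∀ i, 0 ≤ Y i := fun i => Finset.sum_nonneg fun f _ => freeArea_nonneg G hPoly hvol hdisj f
  have hv_nn : ∀ i, 0 ≤ v i := fun i => ENNReal.toReal_nonneg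
  -- volumes
  have hvS : ∀ S : Finset β, (volume (⋃ f ∈ Finset.univ.filter (fun f => cls f ∈ S), G f)).toReal =
      ∑ i ∈ S, v i := fun S => classVolume_sum G hfin hdisj cls S
  have hV : V = ∑ i, v i := by
    have h := hvS Finset.univ
    have hall : Finset.univ.filter (fun f => cls f ∈ (Finset.univ : Finset β)) = Finset.univ := by ext f; simp
    rw [hall] at h
    rw [hVdef]
    have hU : (⋃ f ∈ (Finset.univ : Finset (Fin n)), G f) = ⋃ f, G f := by ext x; simp
    rw [← hU, h]
  have hfloor : ∀ i, Real.sqrt 3 * Y i ≤ F i := fun i =>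
    classFloor_row G hPoly hvol hdisj cls KC hKc hKv hK0 hKs (Real.sqrt_pos.2 (by norm_num)) le_rfl i (hK3 i)
  have hF_nn : ∀ i, 0 ≤ F i := fun i =>
    le_trans (mul_nonneg (Real.sqrt_nonneg 3) (hY_nn i)) (hfloor i)
  ---------------------------------------------------------------- ROWS
  have hblk : ∀ (S : Finset β) (KB : Set E3), IsCompact KB → Convex ℝ KB → (0 : E3) ∈ KB → -KB = KB →
      ∀ (ρ ρq Kq : ℝ), 0 < ρ → ρ ≤ ρq → KB ⊆ Metric.closedBall (0 : E3) ρ → 0 ≤ Kq → Kq ≤ (volume KB).toReal →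
      (∀ i ∈ S, KB ⊆ KC i) →
      3 * Kq ^ ((1 : ℝ) / 3) * (∑ i ∈ S, v i) ^ ((2 : ℝ) / 3) ≤
        (∑ i ∈ S, F i) + ρq * ∑ i ∈ S, ∑ j ∈ Finset.univ \ S, Acl i j := by
    intro S KB hBc hBv hB0 hBs ρ ρq Kq hρ hρq hBR hKq0 hKq hsub
    have h := classBlock_row G hfin hPoly hdisj cls KC hKc hKv hK0 hKs S KB hBc hBv hB0 hBs hρ hρq hBR
      hKq0 hKq hsub
    rw [hvS S] at h
    exact h
  -- bodies for the rows
  have hBall : ∀ r : ℝ, IsCompact (Metric.closedBall (0 : E3) r) ∧ Convex ℝ (Metric.closedBall (0 : E3) r) ∧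
      -Metric.closedBall (0 : E3) r = Metric.closedBall 0 r := fun r =>
    ⟨isCompact_closedBall 0 r, convex_closedBall 0 r, by rw [neg_closedBall, neg_zero]⟩
  have hinter2 : ∀ i j, IsCompact (KC i ∩ KC j) ∧ Convex ℝ (KC i ∩ KC j) ∧ (0 : E3) ∈ KC i ∩ KC j ∧
      -(KC i ∩ KC j) = KC i ∩ KC j := fun i j =>
    ⟨(hKc i).inter (hKc j), (hKv i).inter (hKv j), ⟨hK0 i, hK0 j⟩, by rw [Set.inter_neg, hKs, hKs]⟩
  have hshv : ∀ (K : Set E3) (ε : ℝ), IsCompact K → Convex ℝ K → (0 : E3) ∈ K → -K = K → 0 < ε → ε < 5 →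
      IsCompact (K ∩ Metric.closedBall (0 : E3) (Real.sqrt (5 - ε))) ∧
      Convex ℝ (K ∩ Metric.closedBall (0 : E3) (Real.sqrt (5 - ε))) ∧
      (0 : E3) ∈ K ∩ Metric.closedBall (0 : E3) (Real.sqrt (5 - ε)) ∧
      -(K ∩ Metric.closedBall (0 : E3) (Real.sqrt (5 - ε))) = K ∩ Metric.closedBall (0 : E3) (Real.sqrt (5 - ε)) ∧
      K ∩ Metric.closedBall (0 : E3) (Real.sqrt (5 - ε)) ⊆ Metric.closedBall (0 : E3) (Real.sqrt (5 - ε)) ∧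
      0 < Real.sqrt (5 - ε) := by
    intro K ε hKc' hKv' hK0' hKs' hε hε5
    refine ⟨hKc'.inter (hBall _).1, hKv'.inter (hBall _).2.1, ⟨hK0', Metric.mem_closedBall_self
      (Real.sqrt_nonneg _)⟩, by rw [Set.inter_neg, hKs', (hBall _).2.2], Set.inter_subset_right,
      Real.sqrt_pos.2 (by linarith)⟩
  have hshv_pair : ∀ (i j : β) (ε ρq Kq : ℝ), 0 < ε → ε < 5 → Real.sqrt (5 - ε) ≤ ρq →
      Kq + 8 * ε ^ 3 ≤ 27.8 → 0 ≤ Kq →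
      3 * Kq ^ ((1 : ℝ) / 3) * (∑ k ∈ ({i, j} : Finset β), v k) ^ ((2 : ℝ) / 3) ≤
        (∑ k ∈ ({i, j} : Finset β), F k) + ρq * ∑ k ∈ ({i, j} : Finset β), ∑ l ∈ Finset.univ \ {i, j}, Acl k l := by
    intro i j ε ρq Kq hε hε5 hρq hKq hKq0
    obtain ⟨c1, c2, c3, c4⟩ := hinter2 i j
    obtain ⟨d1, d2, d3, d4, d5, d6⟩ := hshv (KC i ∩ KC j) ε c1 c2 c3 c4 hε hε5
    refine hblk {i, j} _ d1 d2 d3 d4 _ ρq Kq d6 hρq d5 hKq0 ?_ ?_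
    · have hs := hshave i (KC i ∩ KC j) Set.inter_subset_left ε hε hε5.le
      have hp := hpair i j
      norm_num at hp; linarith
    · intro k hk; simp only [Finset.mem_insert, Finset.mem_singleton] at hk
      rcases hk with rfl | rfl
      · exact Set.inter_subset_left.trans Set.inter_subset_left
      · exact Set.inter_subset_left.trans Set.inter_subset_right
  have hshv_single : ∀ (i : β) (ε ρq Kq : ℝ), 0 < ε → ε < 5 → Real.sqrt (5 - ε) ≤ ρq →
      Kq + 8 * ε ^ 3 ≤ 32 → 0 ≤ Kq →
      3 * Kq ^ ((1 : ℝ) / 3) * (v i) ^ ((2 : ℝ) / 3) ≤ F i + ρq * ∑ l ∈ Finset.univ \ {i}, Acl i l := by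
    intro i ε ρq Kq hε hε5 hρq hKq hKq0
    obtain ⟨d1, d2, d3, d4, d5, d6⟩ := hshv (KC i) ε (hKc i) (hKv i) (hK0 i) (hKs i) hε hε5
    have h := hblk {i} _ d1 d2 d3 d4 _ ρq Kq d6 hρq d5 hKq0 ?_ ?_
    · rw [Finset.sum_singleton, Finset.sum_singleton, Finset.sum_singleton] at h; exact h
    · have hs := hshave i (KC i) subset_rfl ε hε hε5.le
      rw [hvolK i] at hs; linarith
    · intro k hk; rw [Finset.mem_singleton] at hk; subst hk; exact Set.inter_subset_left
  have hsq5pos : 0 < Real.sqrt 5 := Real.sqrt_pos.2 (by norm_num)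
  -- unshaved rows
  have hsingle0 : ∀ (i : β) (ρq : ℝ), Real.sqrt 5 ≤ ρq →
      3 * (32 : ℝ) ^ ((1 : ℝ) / 3) * (v i) ^ ((2 : ℝ) / 3) ≤ F i + ρq * ∑ l ∈ Finset.univ \ {i}, Acl i l := by
    intro i ρq hρq
    have h := hblk {i} (KC i) (hKc i) (hKv i) (hK0 i) (hKs i) _ ρq 32 hsq5pos hρq (hK5 i) (by norm_num)
      (by rw [hvolK i]) (fun k hk => by rw [Finset.mem_singleton.1 hk])
    rw [Finset.sum_singleton, Finset.sum_singleton, Finset.sum_singleton] at h; exact h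
  have hpair0 : ∀ (i j : β) (ρq : ℝ), Real.sqrt 5 ≤ ρq →
      3 * (27.8 : ℝ) ^ ((1 : ℝ) / 3) * (∑ k ∈ ({i, j} : Finset β), v k) ^ ((2 : ℝ) / 3) ≤
        (∑ k ∈ ({i, j} : Finset β), F k) + ρq * ∑ k ∈ ({i, j} : Finset β), ∑ l ∈ Finset.univ \ {i, j}, Acl k l := by
    intro i j ρq hρq
    obtain ⟨c1, c2, c3, c4⟩ := hinter2 i j
    refine hblk {i, j} _ c1 c2 c3 c4 _ ρq 27.8 hsq5pos hρq (Set.inter_subset_left.trans (hK5 i)) (by norm_num)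
      (hpair i j) ?_
    intro k hk; simp only [Finset.mem_insert, Finset.mem_singleton] at hk
    rcases hk with rfl | rfl
    · exact Set.inter_subset_left
    · exact Set.inter_subset_right
  have htriple0 : ∀ (i j k : β) (ρq : ℝ), Real.sqrt 5 ≤ ρq →
      3 * (23.6 : ℝ) ^ ((1 : ℝ) / 3) * (∑ l ∈ ({i, j, k} : Finset β), v l) ^ ((2 : ℝ) / 3) ≤
        (∑ l ∈ ({i, j, k} : Finset β), F l) + ρq * ∑ l ∈ ({i, j, k} : Finset β), ∑ l' ∈ Finset.univ \ {i, j, k}, Acl l l' := by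
    intro i j k ρq hρq
    have c1 : IsCompact (KC i ∩ KC j ∩ KC k) := ((hKc i).inter (hKc j)).inter (hKc k)
    have c2 : Convex ℝ (KC i ∩ KC j ∩ KC k) := ((hKv i).inter (hKv j)).inter (hKv k)
    have c3 : (0 : E3) ∈ KC i ∩ KC j ∩ KC k := ⟨⟨hK0 i, hK0 j⟩, hK0 k⟩
    have c4 : -(KC i ∩ KC j ∩ KC k) = KC i ∩ KC j ∩ KC k := by rw [Set.inter_neg, Set.inter_neg, hKs, hKs, hKs]
    have hvi : volume (KC i) = ENNReal.ofReal 32 := by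
      rw [← ENNReal.ofReal_toReal (ne_of_lt (lt_of_le_of_lt (measure_mono (hK5 i))
        (isCompact_closedBall (0 : E3) _).measure_lt_top)), hvolK i]
    have ht : (23.6 : ℝ) ≤ (volume (KC i ∩ KC j ∩ KC k)).toReal := by
      have h := toReal_volume_inter_inter_ge (hKm i) (hKm k) hvi (hpair i j) (hpair i k)
      norm_num at h ⊢; exact h
    refine hblk {i, j, k} _ c1 c2 c3 c4 _ ρq 23.6 hsq5pos hρq
      ((Set.inter_subset_left.trans Set.inter_subset_left).trans (hK5 i)) (by norm_num) ht ?_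
    intro l hl; simp only [Finset.mem_insert, Finset.mem_singleton] at hl
    rcases hl with rfl | rfl | rfl
    · exact Set.inter_subset_left.trans Set.inter_subset_left
    · exact Set.inter_subset_left.trans Set.inter_subset_right
    · exact Set.inter_subset_right
  -- ball blocks
  have hballP : ∀ (P : Finset β) (ρq Kq : ℝ), Real.sqrt 3 ≤ ρq → 0 ≤ Kq → Kq ≤ 4 * Real.sqrt 3 * Real.pi →
      3 * Kq ^ ((1 : ℝ) / 3) * (∑ i ∈ P, v i) ^ ((2 : ℝ) / 3) ≤ (∑ i ∈ P, F i) + ρq * ∑ i ∈ P, ∑ j ∈ Finset.univ \ P, Acl i j := by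
    intro P ρq Kq hρq hKq0 hKq
    obtain ⟨b1, b2, b3⟩ := hBall (Real.sqrt 3)
    exact hblk P _ b1 b2 (Metric.mem_closedBall_self (Real.sqrt_nonneg 3)) b3 _ ρq Kq
      (Real.sqrt_pos.2 (by norm_num)) hρq subset_rfl hKq0 (by rw [toReal_volume_closedBall_sqrt_three]; exact hKq)
      (fun i _ => hK3 i)
  -- iso rows for blocks of classes
  have hisoP : ∀ P : Finset β, 3 * (Real.pi * 4 / 3) ^ ((1 : ℝ) / 3) * (∑ i ∈ P, v i) ^ ((2 : ℝ) / 3) ≤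
      (∑ i ∈ P, Y i) + ∑ i ∈ P, ∑ j ∈ Finset.univ \ P, Acl i j := by
    intro P
    have h := iso_le_block G hfin hPoly hdisj (Finset.univ.filter (fun f => cls f ∈ P))
    have hA := classPair_sum cls wf P
    rw [hvS P] at h
    have hYP : (∑ f ∈ Finset.univ.filter (fun f => cls f ∈ P), Yf f) = ∑ i ∈ P, Y i := by
      rw [← Finset.sum_fiberwise_of_maps_to (g := cls) (t := P) (fun f hf => (Finset.mem_filter.1 hf).2)]
      refine Finset.sum_congr rfl fun i hi => Finset.sum_congr ?_ fun f _ => rfl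
      ext f; simp only [Finset.mem_filter, Finset.mem_univ, true_and, hCdef]
      exact ⟨fun h => h.2, fun h => ⟨h ▸ hi, h⟩⟩
    rw [hYP, hA] at h
    exact h
  -- singles-sum rows
  have hsumP : ∀ (P : Finset β) (ε ρq Kq : ℝ), 0 < ε → ε < 5 → Real.sqrt (5 - ε) ≤ ρq → Kq + 8 * ε ^ 3 ≤ 32 → 0 ≤ Kq →
      3 * Kq ^ ((1 : ℝ) / 3) * (∑ i ∈ P, (v i) ^ ((2 : ℝ) / 3)) ≤ (∑ i ∈ P, F i) + ρq * ∑ i ∈ P, ∑ j ∈ Finset.univ \ {i}, Acl i j := by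
    intro P ε ρq Kq hε hε5 hρq hKq hKq0
    rw [Finset.mul_sum, Finset.mul_sum, ← Finset.sum_add_distrib]
    exact Finset.sum_le_sum fun i _ => hshv_single i ε ρq Kq hε hε5 hρq hKq hKq0
  have hsumP0 : ∀ (P : Finset β) (ρq : ℝ), Real.sqrt 5 ≤ ρq →
      3 * (32 : ℝ) ^ ((1 : ℝ) / 3) * (∑ i ∈ P, (v i) ^ ((2 : ℝ) / 3)) ≤ (∑ i ∈ P, F i) + ρq * ∑ i ∈ P, ∑ j ∈ Finset.univ \ {i}, Acl i j := by
    intro P ρq hρq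
    rw [Finset.mul_sum, Finset.mul_sum, ← Finset.sum_add_distrib]
    exact Finset.sum_le_sum fun i _ => hsingle0 i ρq hρq
  exact ⟨F, Y, Acl, v, rfl, rfl, rfl, rfl, hV, hvS, hv_nn, hF_nn, hY_nn, hAcl_nn, hAcl_symm, hfloor, hshv_single, hshv_pair,
    hsingle0, hpair0, htriple0, hballP, hisoP, hsumP, hsumP0⟩

end Summit.Ventures.Crystal3D.Theorems

end
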